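import Literature.NumberTheory.LFunctions.Zhang2022.KnifeEdgeLenZDegreeShortDenseDual
import Mathlib.Analysis.Real.Pi.Bounds

/-!
# Zhang (2022), rung F-S3 (Landau–Siegel programme, §D edge len = E*-len⁺): route `ZDegreeToeplitzBand` —
# the (D11″) DENSITY LEG of the darkness ports, Part 1: `𝔅(w) ≤ C·‖w‖²_{H¹}` (the `𝔅`-density of POLYNOMIAL short
# pairs among kinked short pairs itself is `KnifeEdgeLenZDegreeShortPolyDense`, p536434)

Y. Zhang, *Discrete mean estimates and the Landau–Siegel zero*, arXiv:2211.02515v1 [Zhang2022LandauSiegel] — an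
unrefereed manuscript under adjudication. **WHAT THIS IS NOT: not a claim about Theorems 1–2 of arXiv:2211.02515, about
Landau–Siegel zeros, or about Parity. The programme SEARCHES and TYPES; no claim about Landau–Siegel zeros, Theorems 1–2
of arXiv:2211.02515 or a repaired Margin232 until a kernel theorem says so.** `E₀`-free; K0 (`KnifeEdge.InClassMean`,
stmt-Parity-20016; repaired as `KnifeEdge.InClassMeanPiece`, stmt-Parity-20459, p535985) and every darkness statement stay
HYPOTHESES — this file ELIMINATES NOTHING. What it PROVES is pure analysis: the «`𝔅(w) ≤ C_𝔅‖w‖²_{H¹}`» half of the pair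
(D11″) behind the approximation hypothesis `hdense` of the tree's density reduction `KnifeEdge.crossTablePsiOn_zero_of_dense`
(`KnifeEdgeLenZDegreeShortDense`, p521442) and of its dual twin (`KnifeEdgeLenZDegreeShortDenseDual`, p528742). The other
half — the `𝔅`-approximation of the half-class `ShortPairs` by the smallest natural smooth sub-class, the POLYNOMIAL short
pairs `KnifeEdge.PolyShortPairs` — landed in parallel as `KnifeEdgeLenZDegreeShortPolyDense` (ls-knife-toeplitz-typer-1,
p536434: `KnifeEdge.exists_polyShortPairs_approx`, `shortPairs_dense_of_poly`, with its own sup-norm form of the bound,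
`KnifeEdge.mainTermForm_le_of_bounds`); the Parts 2–4 once planned for this file were withdrawn in its favour.

This is item (ii) «the `𝔅`-density of pw-C² short pairs among kinked short pairs (pure analysis)» of the pricing of the
three darkness ports stmt-Parity-20429 (`ShortPairsTauTwoDark`), 20444 (`ShortPairsCrossDegOne`), 20445
(`ShortPairsDualDegOne`) of `Summits/Parity/GeneralizedHardyLittlewood/Theses/ZDegreeToeplitzBand.lean` (theory (G1)
2026-08-27 11:21:56Z; M-RULEBOOK (D11″)).

* Part 1 — **`𝔅 ≤ C·H¹`**: for an `H¹` profile `w` with `‖w‖ ≤ M` on `[0,1]`,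
  `𝔅(w) ≤ (8/π + 24)·∫₀¹‖w′‖² + (40 + 136π + 48π²)·M²` (`mainTermForm_le_of_isH1`, term by term on the six-term
  formula (4.1) `mainTermForm_eq`); for a profile vanishing at the top (`w(1) = 0`, every in-class piece) `‖w‖_∞ ≤ ∫₀¹‖w′‖`,
  whence `𝔅(w) ≤ 1000·∫₀¹‖w′‖²` (`mainTermForm_le_of_isH1_of_apply_one_eq_zero`).
-/

noncomputable section

open MeasureTheory Set intervalIntegral Filter
open scoped Real ComplexConjugate Topology

namespace Literature.NumberTheory.LFunctions.Zhang2022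

/-! ### Part 1 — `𝔅(w) ≤ C·‖w‖²_{H¹}` -/

section H1Bound

variable {w w' : ℝ → ℂ}

/-- For an `H¹` profile vanishing at the top, `‖w(y)‖ ≤ ∫₀¹ ‖w′‖` on `[0,1]` (`w(y) = −∫_y¹ w′`) — the one-sided class of
Prop 7.1. [cite: Zhang2022LandauSiegel, Prop 7.1 with (8.11)–(8.23), pp.44–50] -/
theorem IsH1OnUnitInterval.norm_le_integral_norm_deriv_of_apply_one_eq_zero (hw : IsH1OnUnitInterval w w')
    (h1 : w 1 = 0) {y : ℝ} (hy : y ∈ Icc (0:ℝ) 1) :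
    ‖w y‖ ≤ ∫ x in (0:ℝ)..1, ‖w' x‖ := by
  have hI : IntervalIntegrable w' volume 0 1 := hw.intervalIntegrable
  have e1 := hw.eq_add_integral 1 (right_mem_Icc.2 zero_le_one)
  have ey := hw.eq_add_integral y hy
  have hsplit : (∫ x in (0:ℝ)..1, w' x) - ∫ x in (0:ℝ)..y, w' x = ∫ x in y..1, w' x :=
    intervalIntegral.integral_interval_sub_left hI (intervalIntegrable_mono_unit hI hy)
  have hwy : w y = -∫ x in y..1, w' x := by
    rw [← hsplit]
    have : w 0 = -∫ x in (0:ℝ)..1, w' x := by rw [h1] at e1; linear_combination -e1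
    rw [ey, this]
    ring
  rw [hwy, norm_neg]
  calc ‖∫ x in y..1, w' x‖ ≤ ∫ x in y..1, ‖w' x‖ := intervalIntegral.norm_integral_le_integral_norm hy.2
    _ ≤ ∫ x in (0:ℝ)..1, ‖w' x‖ :=
        intervalIntegral.integral_mono_interval hy.1 hy.2 le_rfl
          (Eventually.of_forall fun _ => norm_nonneg _) hI.norm

/-- **`𝔅 ≤ C·H¹`.** For an `H¹` profile `w` on `[0,1]` with `‖w‖ ≤ M` there,
`𝔅(w,w) ≤ (8/π + 24)·∫₀¹‖w′‖² + (40 + 136π + 48π²)·M²` — each of the six terms of (4.1) (`mainTermForm_eq`) bounded by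
`‖w′‖₂`, `‖w′‖₁ ≤ ‖w′‖₂` and `‖w‖_∞` (the main-term form of Prop 7.1 in the glued shape (4.1) of the repair cell).
[cite: Zhang2022LandauSiegel, Prop 7.1 with (8.11)–(8.23), pp.44–50] -/
theorem mainTermForm_le_of_isH1 (hw : IsH1OnUnitInterval w w') {M : ℝ} (hM : ∀ x ∈ Icc (0:ℝ) 1, ‖w x‖ ≤ M) :
    mainTermForm w w' ≤ (8 / π + 24) * (∫ x in (0:ℝ)..1, ‖w' x‖ ^ 2) + (40 + 136 * π + 48 * π ^ 2) * M ^ 2 := by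
  have h0 : (0:ℝ) ∈ Icc (0:ℝ) 1 := left_mem_Icc.2 zero_le_one
  have h1 : (1:ℝ) ∈ Icc (0:ℝ) 1 := right_mem_Icc.2 zero_le_one
  have hM0 : 0 ≤ M := (norm_nonneg _).trans (hM 0 h0)
  have hwc : ContinuousOn w (Icc 0 1) := hw.continuousOn
  have hI : IntervalIntegrable w' volume 0 1 := hw.intervalIntegrable
  have ioc : ∀ {t : ℝ}, t ∈ uIoc (0:ℝ) 1 → t ∈ Icc (0:ℝ) 1 := fun ht => by
    rw [uIoc_of_le zero_le_one] at ht; exact Ioc_subset_Icc_self ht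
  -- the two sizes of `w′`
  set E := ∫ x in (0:ℝ)..1, ‖w' x‖ ^ 2 with hE
  set L := ∫ x in (0:ℝ)..1, ‖w' x‖ with hL
  have hL0 : 0 ≤ L := intervalIntegral.integral_nonneg zero_le_one fun x _ => norm_nonneg _
  have hLE : L ^ 2 ≤ E := sq_integral_norm_le_unit hI hw.intervalIntegrable_sq
  -- T2: `|Im ∫ w′·w̄| ≤ M·L`
  have T2 : |(∫ x in (0:ℝ)..1, w' x * conj (w x)).im| ≤ M * L := by
    refine (Complex.abs_im_le_norm _).trans ?_
    calc ‖∫ x in (0:ℝ)..1, w' x * conj (w x)‖ ≤ ∫ x in (0:ℝ)..1, M * ‖w' x‖ :=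
          intervalIntegral.norm_integral_le_of_norm_le zero_le_one
            (ae_of_all _ fun t ht => by
              rw [norm_mul, Complex.norm_conj, mul_comm]
              exact mul_le_mul_of_nonneg_right (hM t (Ioc_subset_Icc_self ht)) (norm_nonneg _))
            (hI.norm.const_mul M)
      _ = M * L := intervalIntegral.integral_const_mul M _
  -- T3: `∫‖w‖² ≤ M²`
  have T3 : (∫ x in (0:ℝ)..1, ‖w x‖ ^ 2) ≤ M ^ 2 := by
    have hc : IntervalIntegrable (fun x => ‖w x‖ ^ 2) volume 0 1 :=
      ((hwc.norm).pow 2).intervalIntegrable_of_Icc zero_le_one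
    calc (∫ x in (0:ℝ)..1, ‖w x‖ ^ 2) ≤ ∫ x in (0:ℝ)..1, M ^ 2 :=
          intervalIntegral.integral_mono_on zero_le_one hc intervalIntegrable_const fun x hx =>
            pow_le_pow_left₀ (norm_nonneg _) (hM x hx) 2
      _ = M ^ 2 := by simp
  -- T4: `|Im ∫ w·conj(S w)| ≤ M²`
  have T4 : |(∫ x in (0:ℝ)..1, w x * conj (∫ t in (0:ℝ)..x, w t)).im| ≤ M ^ 2 := by
    refine (Complex.abs_im_le_norm _).trans ?_
    have h := intervalIntegral.norm_integral_le_of_norm_le_const (a := (0:ℝ)) (b := 1) (C := M * M)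
      (f := fun x => w x * conj (∫ t in (0:ℝ)..x, w t)) fun t ht => by
        rw [norm_mul, Complex.norm_conj]
        exact mul_le_mul (hM t (ioc ht)) (norm_integral_le_of_le_unit hM0 hM (ioc ht)) (norm_nonneg _) hM0
    simpa [sq] using h
  -- T5: `|Re(conj(∫w)·(w0 + w1))| ≤ 2M²`
  have T5 : |(conj (∫ t in (0:ℝ)..1, w t) * (w 0 + w 1)).re| ≤ 2 * M ^ 2 := by
    refine (Complex.abs_re_le_norm _).trans ?_
    rw [norm_mul, Complex.norm_conj]
    have hi : ‖∫ t in (0:ℝ)..1, w t‖ ≤ M := norm_integral_le_of_le_unit hM0 hM h1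
    have hs : ‖w 0 + w 1‖ ≤ M + M := (norm_add_le _ _).trans (add_le_add (hM 0 h0) (hM 1 h1))
    calc ‖∫ t in (0:ℝ)..1, w t‖ * ‖w 0 + w 1‖ ≤ M * (M + M) := mul_le_mul hi hs (norm_nonneg _) hM0
      _ = 2 * M ^ 2 := by ring
  -- T6: `|Im(w0·conj w1)| ≤ M²`
  have T6 : |(w 0 * conj (w 1)).im| ≤ M ^ 2 := by
    refine (Complex.abs_im_le_norm _).trans ?_
    rw [norm_mul, Complex.norm_conj, sq]
    exact mul_le_mul (hM 0 h0) (hM 1 h1) (norm_nonneg _) hM0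
  -- assemble
  have hπ : 0 < π := Real.pi_pos
  have a2 : 48 * (∫ x in (0:ℝ)..1, w' x * conj (w x)).im ≤ 24 * M ^ 2 + 24 * E := by
    have := (abs_le.1 T2).2
    nlinarith [sq_nonneg (M - L)]
  have a3 : 88 * π * (∫ x in (0:ℝ)..1, ‖w x‖ ^ 2) ≤ 88 * π * M ^ 2 :=
    mul_le_mul_of_nonneg_left T3 (by positivity)
  have a4 : 48 * π ^ 2 * (∫ x in (0:ℝ)..1, w x * conj (∫ t in (0:ℝ)..x, w t)).im ≤ 48 * π ^ 2 * M ^ 2 :=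
    mul_le_mul_of_nonneg_left (abs_le.1 T4).2 (by positivity)
  have a5 : -(24 * π * (conj (∫ t in (0:ℝ)..1, w t) * (w 0 + w 1)).re) ≤ 24 * π * (2 * M ^ 2) := by
    rw [← mul_neg]
    exact mul_le_mul_of_nonneg_left (neg_le.1 (abs_le.1 T5).1) (by positivity)
  have a6 : 16 * (w 0 * conj (w 1)).im ≤ 16 * M ^ 2 := by linarith [(abs_le.1 T6).2]
  rw [mainTermForm_eq]
  nlinarith [a2, a3, a4, a5, a6]

/-- **`𝔅 ≤ 1000·‖w′‖₂²` for profiles vanishing at the top** (every in-class piece, `w(1) = 0`): then `‖w‖_∞ ≤ ‖w′‖₁ ≤ ‖w′‖₂`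
and `8/π + 24 + 40 + 136π + 48π² < 1000`. [cite: Zhang2022LandauSiegel, Prop 7.1 with (8.11)–(8.23), pp.44–50] -/
theorem mainTermForm_le_of_isH1_of_apply_one_eq_zero (hw : IsH1OnUnitInterval w w') (h1 : w 1 = 0) :
    mainTermForm w w' ≤ 1000 * ∫ x in (0:ℝ)..1, ‖w' x‖ ^ 2 := by
  set E := ∫ x in (0:ℝ)..1, ‖w' x‖ ^ 2 with hE
  set L := ∫ x in (0:ℝ)..1, ‖w' x‖ with hL
  have hE0 : 0 ≤ E := intervalIntegral.integral_nonneg zero_le_one fun x _ => sq_nonneg _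
  have hLE : L ^ 2 ≤ E := sq_integral_norm_le_unit hw.intervalIntegrable hw.intervalIntegrable_sq
  have hb := mainTermForm_le_of_isH1 hw (M := L)
    fun x hx => hw.norm_le_integral_norm_deriv_of_apply_one_eq_zero h1 hx
  have hπ3 : 3 < π := Real.pi_gt_three
  have hπ4 : π < 3.15 := Real.pi_lt_d2
  have hπi : 8 / π ≤ 8 / 3 := div_le_div_of_nonneg_left (by norm_num) (by norm_num) hπ3.le
  have hK : 40 + 136 * π + 48 * π ^ 2 ≤ 945 := by nlinarith
  calc mainTermForm w w' ≤ (8 / π + 24) * E + (40 + 136 * π + 48 * π ^ 2) * L ^ 2 := hb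
    _ ≤ (8 / 3 + 24) * E + 945 * E := by
        have := mul_le_mul hK hLE (sq_nonneg L) (by norm_num)
        nlinarith
    _ ≤ 1000 * E := by nlinarith

end H1Bound

end Literature.NumberTheory.LFunctions.Zhang2022

end
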